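import Summits.BirchSwinnertonDyer.BirchSwinnertonDyer.Theorems.AlignedTransportAtTwoMainConjectureTransportAlignedAtTwoKilfordCopyCrossLevelSquarefree
import HarnessLib

/-!
# Crux C1 `MainConjectureTransportAlignedAtTwo` (stmt-BirchSwinnertonDyer-22296), line `birth`, residual (R2) `stub_lamLawKilford`, UNEQUAL conductors:
# THE INTERMEDIATE-LEVEL REDUCTION FOR A SQUAREFREE RATIO `N₂ = N₁·m` — packaging of the iterated absorption: the `m`-old line `F = ∑_{d∣m} d·ι_d f₁`
# and «same half-kernel at level `N₂` of `(c₁·y(F), c₂·y(f₂))` ⟹ same depleted half-kernel» (width seat att-p3 g18; `--supports 22296`)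

THEOREMS ONLY (no `def`, no `sorry`, no named fact). Sequel of `…KilfordCopyCrossLevelSquarefree` (`oldLines_absorb`); pure period bookkeeping; BSD is not
proved by this; C1 is not closed by this. Generalises `…KilfordCopyCrossLevel.sameKernel_depleted_of_sameKernel_oldLine` (the case `m = q` prime, both cell′
members) to every squarefree `m = ∏_{q∈Q} q` prime to `N₁` with `E₁` good (`a_q(f₁)` even) and `E₂` multiplicative (`a_q(f₂)` odd) at every `q ∣ m` —
the one-sided SEMISTABLE shape; att-p5 g18's fourth engine tests these composite ratios next (`δ = Σ_{d∣m} α_d^*`, levels 5030, 6034, 12426, …).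

* §1 `act_prod_oldLines_eq_sum` — `(∏_{q∈Q}([1]+[q]))·ψ (x) = Σ_{T⊆Q} ψ((∏T)·x)`; `cuspCoeff_finset_sum`, `modularSymbol_finset_sum`; the `m`-old line:
  `exists_oldLines` and **`modularSymbol_oldLines`** (`a_n(F) = Σ_{T⊆Q} (∏T)·a_{n/∏T}(f)` ⟹ `{∞,s}_F = Σ_{T⊆Q} {∞, (∏T)s}_f`).
* §2 **`sameKernel_depleted_of_sameKernel_oldLines`** (abstract lattices) — the reduction for `N₂ = N₁·∏Q`.

References: Greenberg–Vatsal 2000 §3 [GreenbergVatsal2000]; Emerton–Pollack–Weston 2006 §3 (3.4)–(3.5) [EmertonPollackWeston2006]; Cremona 1997 §2.4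
[CremonaAlgorithms1997]; Diamond–Shurman §5.7 [DiamondShurman2005].
-/

noncomputable section

-- justification: the `Summit.BirchSwinnertonDyer.BirchSwinnertonDyer.…` path repeats a component (route-file convention)
set_option linter.dupNamespace false
set_option autoImplicit false

open scoped MatrixGroups ModularForm Classical

open CongruenceSubgroup Complex
open Literature.NumberTheory.EllipticCurves Literature.NumberTheory.EllipticCurves.ModularForms
open Summit.BirchSwinnertonDyer.BirchSwinnertonDyer.Theorems.ThetaLayerLambdaCongruenceAtTwo
open Summit.BirchSwinnertonDyer.BirchSwinnertonDyer.Theorems.AlignedTransportAtTwoDepletedPeriodFormula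
open Summit.BirchSwinnertonDyer.BirchSwinnertonDyer.Theorems.MazurTateCongruenceAtTwoR.DepletedLattice (modularSymbol_iota)
open Summit.BirchSwinnertonDyer.BirchSwinnertonDyer.Theorems.AlignedTransportAtTwoKilfordCopyCrossLevelTools
open Summit.BirchSwinnertonDyer.BirchSwinnertonDyer.Theorems.AlignedTransportAtTwoKilfordCopyCrossLevelSquarefree

namespace Summit.BirchSwinnertonDyer.BirchSwinnertonDyer.Theorems.AlignedTransportAtTwoKilfordCopyCrossLevelSquarefreePairs

/-! ## §1 The old-lines operator as a divisor sum, and the `m`-old line `F = ∑_{T⊆Q} (∏T)·ι_{∏T} f` -/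

/-- **`(∏_{q∈Q}([1]+[q]))·ψ (x) = Σ_{T⊆Q} ψ((∏_{q∈T} q)·x)`** (expansion over the subsets of `Q`). [folklore] -/
theorem act_prod_oldLines_eq_sum (ψ : ℚ → ℂ) (Q : Finset ℕ) :
    ∀ x : ℚ, (((∏ q ∈ Q, (MonoidAlgebra.single 1 (1 : ℂ) + MonoidAlgebra.single q (1 : ℂ)) : MonoidAlgebra ℂ ℕ).coeff.sum
        fun m a ↦ a * ψ ((m : ℚ) * x))) = ∑ T ∈ Q.powerset, ψ (((∏ q ∈ T, q : ℕ) : ℚ) * x) := by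
  classical
  induction Q using Finset.induction_on with
  | empty =>
    intro x
    rw [Finset.prod_empty, MonoidAlgebra.one_def, act_single, one_mul, Finset.powerset_empty, Finset.sum_singleton, Finset.prod_empty]
  | insert q Q hqQ ih =>
    intro x
    rw [act_prod_oldLines_insert ψ hqQ, ih, ih, Finset.powerset_insert, Finset.sum_union, Finset.sum_image]
    · congr 1
      refine Finset.sum_congr rfl fun T hT ↦ ?_
      have hqT : q ∉ T := fun h ↦ hqQ (Finset.mem_powerset.mp hT h)
      rw [Finset.prod_insert hqT]
      exact congrArg ψ (by push_cast; ring)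
    · intro T₁ hT₁ T₂ hT₂ h
      have h₁ : q ∉ T₁ := fun h' ↦ hqQ (Finset.mem_powerset.mp (Finset.mem_coe.mp hT₁) h')
      have h₂ : q ∉ T₂ := fun h' ↦ hqQ (Finset.mem_powerset.mp (Finset.mem_coe.mp hT₂) h')
      rw [← Finset.erase_insert h₁, h, Finset.erase_insert h₂]
    · rw [Finset.disjoint_left]
      intro T hT hT'
      obtain ⟨T₀, _, rfl⟩ := Finset.mem_image.mp hT'
      exact hqQ (Finset.mem_powerset.mp hT (Finset.mem_insert_self q T₀))

/-- `q`-expansion coefficients of a finite sum of cusp forms. [folklore] -/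
theorem cuspCoeff_finset_sum {L : ℕ} {ι : Type*} (s : Finset ι) (G : ι → CuspForm (Gamma0 L) 2) (n : ℕ) :
    cuspCoeff (∑ i ∈ s, G i) n = ∑ i ∈ s, cuspCoeff (G i) n := by
  classical
  induction s using Finset.induction_on with
  | empty => simp [cuspCoeff, UpperHalfPlane.qExpansion_zero]
  | insert i s hi ih => rw [Finset.sum_insert hi, Finset.sum_insert hi, cuspCoeff, qExpansion_coeff_add_level0, ← cuspCoeff, ← cuspCoeff, ih]

/-- Modular symbols of a finite sum of cusp forms. [folklore] -/
theorem modularSymbol_finset_sum {L : ℕ} [NeZero L] {ι : Type*} (s : Finset ι) (G : ι → CuspForm (Gamma0 L) 2) (r : ℚ) :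
    modularSymbol (∑ i ∈ s, G i) r = ∑ i ∈ s, modularSymbol (G i) r := by
  classical
  induction s using Finset.induction_on with
  | empty =>
    rw [Finset.sum_empty, Finset.sum_empty]
    have h := modularSymbol_const_smul (0 : ℂ) (0 : CuspForm (Gamma0 L) 2) r
    rwa [zero_smul, zero_mul] at h
  | insert i s hi ih => rw [Finset.sum_insert hi, Finset.sum_insert hi, modularSymbol_add, ih]

/-- **The `m`-old line exists** (`m = ∏_{q∈Q} q`, `N₁·m ∣ L`, all `q ∈ Q` non-zero): a form `F ∈ S₂(Γ₀(L))` with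
`a_n(F) = Σ_{T⊆Q} (∏T)·a_{n/∏T}(f)` — namely `Σ_{T⊆Q} (∏T)·ι_{∏T} f`. [cite: DiamondShurman2005, §5.7] -/
theorem exists_oldLines {N₁ L : ℕ} (Q : Finset ℕ) (hQ0 : ∀ q ∈ Q, q ≠ 0) (hL : N₁ * ∏ q ∈ Q, q ∣ L) (f : CuspForm (Gamma0 N₁) 2) :
    ∃ F : CuspForm (Gamma0 L) 2, ∀ n : ℕ, cuspCoeff F n =
      ∑ T ∈ Q.powerset, ((∏ q ∈ T, q : ℕ) : ℂ) * (if (∏ q ∈ T, q) ∣ n then cuspCoeff f (n / ∏ q ∈ T, q) else 0) := by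
  classical
  have hne : ∀ T ∈ Q.powerset, (∏ q ∈ T, q) ≠ 0 := fun T hT ↦
    Finset.prod_ne_zero_iff.mpr fun q hq ↦ hQ0 q (Finset.mem_powerset.mp hT hq)
  have hdiv : ∀ T ∈ Q.powerset, N₁ * ∏ q ∈ T, q ∣ L := fun T hT ↦
    (mul_dvd_mul_left N₁ (Finset.prod_dvd_prod_of_subset _ _ _ (Finset.mem_powerset.mp hT))).trans hL
  refine ⟨∑ T ∈ Q.powerset.attach, ((∏ q ∈ T.1, q : ℕ) : ℂ) •
    @iota N₁ L (∏ q ∈ T.1, q) ⟨hne T.1 T.2⟩ 2 (hdiv T.1 T.2) f, fun n ↦ ?_⟩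
  rw [cuspCoeff_finset_sum, ← Finset.sum_attach Q.powerset]
  refine Finset.sum_congr rfl fun T _ ↦ ?_
  haveI : NeZero (∏ q ∈ T.1, q) := ⟨hne T.1 T.2⟩
  simp only [cuspCoeff, qExpansion_coeff_smul, qExpansion_coeff_iota]

/-- **Modular symbols of the `m`-old line**: `a_n(F) = Σ_{T⊆Q} (∏T)·a_{n/∏T}(f)` ⟹ `{∞, s}_F = Σ_{T⊆Q} {∞, (∏T)·s}_f = ((∏_{q∈Q}([1]+[q]))·{∞,·}_f)(s)`
(`q`-expansion principle; `{∞,s}_{ι_d f} = d⁻¹{∞, ds}_f`). [cite: CremonaAlgorithms1997, §2.4] -/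
theorem modularSymbol_oldLines {N₁ L : ℕ} [NeZero N₁] [NeZero L] (Q : Finset ℕ) (hQ0 : ∀ q ∈ Q, q ≠ 0) (hL : N₁ * ∏ q ∈ Q, q ∣ L)
    (f : CuspForm (Gamma0 N₁) 2) (F : CuspForm (Gamma0 L) 2)
    (hF : ∀ n : ℕ, cuspCoeff F n = ∑ T ∈ Q.powerset, ((∏ q ∈ T, q : ℕ) : ℂ) * (if (∏ q ∈ T, q) ∣ n then cuspCoeff f (n / ∏ q ∈ T, q) else 0))
    (s : ℚ) :
    modularSymbol F s = ((∏ q ∈ Q, (MonoidAlgebra.single 1 (1 : ℂ) + MonoidAlgebra.single q (1 : ℂ)) : MonoidAlgebra ℂ ℕ).coeff.sum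
      fun m a ↦ a * modularSymbol f ((m : ℚ) * s)) := by
  classical
  have hne : ∀ T ∈ Q.powerset, (∏ q ∈ T, q) ≠ 0 := fun T hT ↦
    Finset.prod_ne_zero_iff.mpr fun q hq ↦ hQ0 q (Finset.mem_powerset.mp hT hq)
  have hdiv : ∀ T ∈ Q.powerset, N₁ * ∏ q ∈ T, q ∣ L := fun T hT ↦
    (mul_dvd_mul_left N₁ (Finset.prod_dvd_prod_of_subset _ _ _ (Finset.mem_powerset.mp hT))).trans hL
  have hFe : F = ∑ T ∈ Q.powerset.attach, ((∏ q ∈ T.1, q : ℕ) : ℂ) •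
      @iota N₁ L (∏ q ∈ T.1, q) ⟨hne T.1 T.2⟩ 2 (hdiv T.1 T.2) f := by
    refine eq_of_forall_cuspCoeff_eq_gamma0 fun n ↦ ?_
    rw [hF n, cuspCoeff_finset_sum, ← Finset.sum_attach Q.powerset]
    refine Finset.sum_congr rfl fun T _ ↦ ?_
    haveI : NeZero (∏ q ∈ T.1, q) := ⟨hne T.1 T.2⟩
    simp only [cuspCoeff, qExpansion_coeff_smul, qExpansion_coeff_iota]
  rw [act_prod_oldLines_eq_sum, hFe, modularSymbol_finset_sum, ← Finset.sum_attach Q.powerset]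
  refine Finset.sum_congr rfl fun T _ ↦ ?_
  haveI : NeZero (∏ q ∈ T.1, q) := ⟨hne T.1 T.2⟩
  have h0 : ((∏ q ∈ T.1, q : ℕ) : ℂ) ≠ 0 := by exact_mod_cast hne T.1 T.2
  rw [modularSymbol_const_smul, modularSymbol_iota, ← mul_assoc, mul_inv_cancel₀ h0, one_mul]

/-! ## §2 THE REDUCTION for `N₂ = N₁·m`, `m = ∏_{q∈Q} q` squarefree and prime to `N₁` -/

/-- **Cross-level same-kernel from the intermediate level, squarefree ratio (abstract lattices).** `f₁ ∈ S₂(Γ₀(N₁))`, `f₂ ∈ S₂(Γ₀(N₂))`,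
`N₂ = N₁·∏_{q∈Q} q` with `Q` a set of primes not dividing `N₁`; Hecke eigenforms with integer coefficients `Aᵢ`; for `q ∈ Q`: `a_q(f₁)` EVEN and
`a_q(f₂)` ODD (`E₁` good with unipotent Frobenius, `E₂` multiplicative); `S ⊇ Q` odd primes with `a_ℓ(f₁) ≡ a_ℓ(f₂)` on `S ∖ Q`; `gᵢ` the `S`-depleted
forms at `N'` with `N₂∏ℓ² ∣ N'`; `F₁ ∈ S₂(Γ₀(N₂))` the `m`-old line of `f₁` (`a_n(F₁) = Σ_{T⊆Q} (∏T)·a_{n/∏T}(f₁)`); `Λᵢ ⊇ cᵢΛ_{fᵢ}`. IF the half-kernels of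
`y ↦ c₁·y(F₁)` and `y ↦ c₂·y(f₂)` on `H₁(X₀(N₂);ℤ)` agree THEN the half-kernels of the depleted functionals on `H₁(X₀(N');ℤ)` agree.
[cite: GreenbergVatsal2000, §3] [cite: EmertonPollackWeston2006, §3 (3.4)–(3.5)] [cite: CremonaAlgorithms1997, §2.4] -/
theorem sameKernel_depleted_of_sameKernel_oldLines
    {N₁ N₂ : ℕ} [NeZero N₁] [NeZero N₂] (Q : Finset ℕ) (hQ : ∀ q ∈ Q, q.Prime) (hQN₁ : ∀ q ∈ Q, ¬ q ∣ N₁)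
    (hN₂ : N₂ = N₁ * ∏ q ∈ Q, q)
    (f₁ : CuspForm (Gamma0 N₁) 2) (f₂ : CuspForm (Gamma0 N₂) 2)
    (A₁ A₂ : ℕ → ℤ) (hA₁ : ∀ n, cuspCoeff f₁ n = A₁ n) (hA₂ : ∀ n, cuspCoeff f₂ n = A₂ n)
    (hT₁ : ∀ (p : ℕ) (hp : p.Prime), (haveI : NeZero p := ⟨hp.ne_zero⟩; heckeT (Gamma0 N₁) 2 p f₁) = cuspCoeff f₁ p • f₁)
    (hT₂ : ∀ (p : ℕ) (hp : p.Prime), (haveI : NeZero p := ⟨hp.ne_zero⟩; heckeT (Gamma0 N₂) 2 p f₂) = cuspCoeff f₂ p • f₂)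
    (hq₁ : ∀ q ∈ Q, Even (A₁ q)) (hq₂ : ∀ q ∈ Q, Odd (A₂ q))
    (S : Finset ℕ) (hS : ∀ ℓ ∈ S, ℓ.Prime) (hSodd : ∀ ℓ ∈ S, Odd ℓ) (hQS : Q ⊆ S)
    (hAS : ∀ ℓ ∈ S, ℓ ∉ Q → (2 : ℤ) ∣ A₁ ℓ - A₂ ℓ)
    (N' : ℕ) [NeZero N'] (hN' : N₂ * ∏ ℓ ∈ S, ℓ ^ 2 ∣ N')
    (g₁ g₂ : CuspForm (Gamma0 N') 2)
    (hg₁ : ∀ n, cuspCoeff g₁ n = if ∃ ℓ ∈ S, ℓ ∣ n then 0 else cuspCoeff f₁ n)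
    (hg₂ : ∀ n, cuspCoeff g₂ n = if ∃ ℓ ∈ S, ℓ ∣ n then 0 else cuspCoeff f₂ n)
    (F₁ : CuspForm (Gamma0 N₂) 2)
    (hF₁ : ∀ n : ℕ, cuspCoeff F₁ n =
      ∑ T ∈ Q.powerset, ((∏ q ∈ T, q : ℕ) : ℂ) * (if (∏ q ∈ T, q) ∣ n then cuspCoeff f₁ (n / ∏ q ∈ T, q) else 0))
    (Λ₁ Λ₂ : AddSubgroup ℂ) (c₁ c₂ : ℂ)
    (hc₁ : ∀ z ∈ periodLattice f₁, c₁ * z ∈ Λ₁) (hc₂ : ∀ z ∈ periodLattice f₂, c₂ * z ∈ Λ₂)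
    (hker : ∀ y ∈ periodHomology N₂, c₁ * y F₁ / 2 ∈ Λ₁ ↔ c₂ * y f₂ / 2 ∈ Λ₂) :
    ∀ x ∈ periodHomology N',
      c₁ * (((∏ ℓ ∈ S, ℓ ^ 2 : ℕ) : ℂ) * x g₁) / 2 ∈ Λ₁ ↔ c₂ * (((∏ ℓ ∈ S, ℓ ^ 2 : ℕ) : ℂ) * x g₂) / 2 ∈ Λ₂ := by
  classical
  intro x hx
  have hM0 : (∏ ℓ ∈ S, ℓ ^ 2) ≠ 0 := Finset.prod_ne_zero_iff.mpr fun ℓ hℓ ↦ pow_ne_zero 2 (hS ℓ hℓ).ne_zero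
  have hQ0 : ∀ q ∈ Q, q ≠ 0 := fun q hq ↦ (hQ q hq).ne_zero
  have hN₁Q : N₁ * ∏ q ∈ Q, q ∣ N₂ := by rw [hN₂]
  -- `x` is the period functional of one `γ ∈ Γ₀(N')`
  have hx' : x ∈ (periodHomology N' : Set (Module.Dual ℂ (CuspForm (Gamma0 N') 2))) := hx
  rw [coe_periodHomology_eq_range] at hx'
  obtain ⟨γ, rfl⟩ := hx'
  simp only [periodFunctional_apply]
  by_cases hγ : (γ : SL(2, ℤ)) 1 0 = 0
  · simp only [cuspSymbol, if_pos hγ, mul_zero, zero_div, Λ₁.zero_mem, Λ₂.zero_mem]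
  set r : ℚ := (((γ : SL(2, ℤ)) 0 0 : ℚ) / ((γ : SL(2, ℤ)) 1 0 : ℚ)) with hr
  have hcusp : ∀ g : CuspForm (Gamma0 N') 2, cuspSymbol g γ = modularSymbol g r := fun g ↦ by
    rw [cuspSymbol, if_neg hγ]
  rw [hcusp, hcusp]
  -- the `f₂`-side
  have hΛ₂ : ∀ m : ℕ, m ∣ ∏ ℓ ∈ S, ℓ ^ 2 → c₂ * modularSymbol f₂ ((m : ℚ) * r) ∈ Λ₂ := by
    intro m hm
    obtain ⟨δ, hδ, hδr⟩ := exists_gamma0_dilate_cusp (ne_zero_of_dvd_ne_zero hM0 hm) ((mul_dvd_mul_left _ hm).trans hN') γ hγ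
    have h : cuspSymbol f₂ δ = modularSymbol f₂ ((m : ℚ) * r) := by rw [cuspSymbol, if_neg hδ, hδr]
    rw [← h]
    exact hc₂ _ (cuspSymbol_mem_periodLattice f₂ δ)
  have hdep₂ := modularSymbol_depleted_eq_act_of_dvd f₂ hT₂ S hS N' hN' g₂ hg₂ r
  have hℓ0 : ∀ ℓ ∈ S, (ℓ : ℂ) ≠ 0 := fun ℓ hℓ ↦ by exact_mod_cast (hS ℓ hℓ).ne_zero
  have hu₂ : ∀ ℓ ∈ S, (ℓ : ℂ) * (-(cuspCoeff f₂ ℓ) * (ℓ : ℂ)⁻¹) = ((-A₂ ℓ : ℤ) : ℂ) := fun ℓ hℓ ↦ by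
    rw [hA₂, mul_comm, mul_assoc, inv_mul_cancel₀ (hℓ0 ℓ hℓ), mul_one, Int.cast_neg]
  have hv₂ : ∀ ℓ ∈ S, (ℓ : ℂ) * (if ℓ ∣ N₂ then 0 else (ℓ : ℂ)⁻¹) = ((if ℓ ∣ N₂ then 0 else 1 : ℤ) : ℂ) :=
    fun ℓ hℓ ↦ by split_ifs <;> simp [mul_inv_cancel₀ (hℓ0 ℓ hℓ)]
  obtain ⟨z₂, hz₂, h₂⟩ := mul_act_prod_congr_mod_two Λ₂ (modularSymbol f₂) c₂
    (fun ℓ ↦ -(cuspCoeff f₂ ℓ) * (ℓ : ℂ)⁻¹) (fun ℓ ↦ if ℓ ∣ N₂ then 0 else (ℓ : ℂ)⁻¹)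
    (fun ℓ ↦ -A₂ ℓ) (fun ℓ ↦ if ℓ ∣ N₂ then 0 else 1)
    (fun ℓ ↦ -A₂ ℓ) (fun ℓ ↦ if ℓ ∣ N₂ then 0 else 1)
    S hSodd hu₂ hv₂ (fun ℓ _ ↦ by simp) (fun ℓ _ ↦ by simp) r hΛ₂
  -- the `f₁`-side: iterated absorption through `F₁` with the Euler data of `f₂`
  have hdvdQ : ∀ ℓ : ℕ, ℓ.Prime → ℓ ∉ Q → ¬ ℓ ∣ ∏ q ∈ Q, q := by
    intro ℓ hℓ hℓQ h
    obtain ⟨q, hq, hℓq⟩ := (Prime.dvd_finsetProd_iff hℓ.prime _).mp h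
    exact hℓQ (((Nat.prime_dvd_prime_iff_eq hℓ (hQ q hq)).mp hℓq) ▸ hq)
  have hB' : ∀ ℓ ∈ S, ℓ ∉ Q → (2 : ℤ) ∣ -A₁ ℓ - -A₂ ℓ := fun ℓ hℓ hℓQ ↦ by
    rw [show -A₁ ℓ - -A₂ ℓ = -(A₁ ℓ - A₂ ℓ) by ring]
    exact (hAS ℓ hℓ hℓQ).neg_right
  have hE' : ∀ ℓ ∈ S, ℓ ∉ Q → (2 : ℤ) ∣ (if ℓ ∣ N₁ then 0 else 1) - (if ℓ ∣ N₂ then 0 else 1 : ℤ) := by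
    intro ℓ hℓ hℓQ
    have hiff : ℓ ∣ N₂ ↔ ℓ ∣ N₁ := by
      rw [hN₂]
      refine ⟨fun h ↦ ?_, fun h ↦ h.mul_right _⟩
      rcases (Nat.Prime.dvd_mul (hS ℓ hℓ)).mp h with h | h
      · exact h
      · exact absurd h (hdvdQ ℓ (hS ℓ hℓ) hℓQ)
    by_cases hℓN : ℓ ∣ N₁
    · rw [if_pos hℓN, if_pos (hiff.mpr hℓN), sub_self]; exact dvd_zero 2
    · rw [if_neg hℓN, if_neg (fun h ↦ hℓN (hiff.mp h)), sub_self]; exact dvd_zero 2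
  have hE0 : ∀ q ∈ Q, (fun ℓ ↦ if ℓ ∣ N₂ then (0 : ℤ) else 1) q = 0 := fun q hq ↦ by
    show (if q ∣ N₂ then (0 : ℤ) else 1) = 0
    rw [if_pos (hN₂ ▸ (Finset.dvd_prod_of_mem _ hq).mul_left N₁)]
  obtain ⟨z₁, hz₁, h₁⟩ := oldLines_absorb f₁ A₁ hA₁ hT₁ S hS hSodd N' Λ₁ c₁ hc₁ g₁ hg₁ γ hγ Q hQS hQN₁ hq₁
    (by rw [← hN₂]; exact hN') (fun ℓ ↦ -A₂ ℓ) (fun ℓ ↦ if ℓ ∣ N₂ then 0 else 1) hB' hE' (fun q hq ↦ (hq₂ q hq).neg) hE0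
  -- ONE cycle `y ∈ H₁(X₀(N₂);ℤ)` computing the common integer operator on every form of level `N₂`
  obtain ⟨y, hy, hyH⟩ := exists_mem_periodHomology_apply_eq_act N₂ (fun ℓ ↦ -A₂ ℓ)
    (fun ℓ ↦ if ℓ ∣ N₂ then 0 else 1) S r (fun m hm ↦
      exists_gamma0_dilate_cusp (ne_zero_of_dvd_ne_zero hM0 hm) ((mul_dvd_mul_left _ hm).trans hN') γ hγ)
  have E1 : c₁ * (((∏ ℓ ∈ S, ℓ ^ 2 : ℕ) : ℂ) * modularSymbol g₁ r) = c₁ * y F₁ + 2 * z₁ := by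
    rw [hyH F₁]
    simp only [modularSymbol_oldLines Q hQ0 hN₁Q f₁ F₁ hF₁]
    exact h₁
  have E2 : c₂ * (((∏ ℓ ∈ S, ℓ ^ 2 : ℕ) : ℂ) * modularSymbol g₂ r) = c₂ * y f₂ + 2 * z₂ := by
    rw [hdep₂, hyH f₂]
    linear_combination h₂
  rw [div_two_mem_iff_of_eq_add Λ₁ hz₁ E1, div_two_mem_iff_of_eq_add Λ₂ hz₂ E2]
  exact hker y hy

end Summit.BirchSwinnertonDyer.BirchSwinnertonDyer.Theorems.AlignedTransportAtTwoKilfordCopyCrossLevelSquarefreePairs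

end
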